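import Literature.MathematicalPhysics.QuantumFieldTheory.Balaban1983to89.B1Cor23RegularRegion
import Literature.MathematicalPhysics.QuantumFieldTheory.Balaban1983to89.B1Ineq233LowerRegularOnRegion
import Literature.MathematicalPhysics.QuantumFieldTheory.Balaban1983to89.B1Ineq234ZeroFieldRegionUniform

/-!
# `Balaban1983to89.B1Prop23RegularRegion` — T. Bałaban, *(Higgs)₂,₃ quantum fields in a finite volume. I. A lower bound*,
# Commun. Math. Phys. **85** (1982) 603–626 [Balaban1982Higgs1], **PROPOSITION 2.2 (2.27) AND PROPOSITION 2.3 (2.34)/(2.36)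
# AT A REGULAR `A ≠ 0` FOR THE PRINTED REGIONS `Ω = B^k(Λ_k)`**, `Λ_k ⊂ T^{(k)}` a union of blocks, `Λ ⊂ Λ_k`, `1 ≤ k < K`, on the
# concrete (Higgs)₂,₃ carrier — the [13] Sect.-5 route *"Finally Corollary 2.3 implies that the considered operator is short-ranged
# … (5.4) … Proposition I.2.3 is a consequence of the following Theorem"* ([Balaban1983RegularityDecay] pp. 593–594) with BOTH `A ≠ 0`
# inputs now in the tree for regions: r14 g14's Cor. 2.3 first pairing at a regular `A` (`B1Cor23RegularRegion`) and r14 g13's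
# (2.33)ₗ at a background regular on `Ω` (`B1Ineq233LowerRegularOnRegion`)

statement-level skeleton of published theorems with citation tags; proofs where landed; nothing here is a claim about the Yang–Mills mass gap

PDF held: `paper:balaban1982-cmp85-higgs23-i` (journal page = PDF page + 602), p. 611 [PDF 9] Props. 2.2–2.3 (2.27), (2.33)–(2.35),
p. 612 [PDF 10] (2.36), p. 610 [PDF 8] (2.20)–(2.23) (OCR `p0009.txt`/`p0008.txt` re-read by this seat; the displays (2.33)/(2.34)
are illegible in the OCR and were read on the page render by ref-1); [Balaban1983RegularityDecay] = `paper:balaban1983-cmp89-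
regularity-decay` p. 580 [PDF 10] Cor. 2.3, pp. 593–594 [PDF 23–24] (5.4)–(5.6) (v1.1: (5.4) and «Finally Corollary 2.3 implies …» are on
p. 593 = PDF 23 l. 35–37 — ref-4 S-B1-g42-2; doc-only, no declaration changed).

CITATION HEADER (lean-in-tree rule).  Cell `lit-balaban` (HOME `run/shared/lean/pub/lit-balaban/`), reader/typer seat **r14** gen 14
(unit `lit-balaban-r14`, B1 fold owner; TAKING line HOME/STATUS.md 2026-08-22T07:18:39Z).  SKELETON rows **B1.Prop2.2** (decl of
record `B1.prop22_kernelDecay`; head by p17's b04-carrier instance) and **B1.Prop2.3** (`B1.Prop23Literal`/`Prop23Intended`; head by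
p17's `B4Prop23RegularFamily` on the b04 carrier; concrete-carrier instances so far: `A = 0` regions r14 g9, `A = A^{(k),ε}` on
`Ω = T_ε` r14 g13) — THIS file is the FIRST `A ≠ 0` MODEL INSTANCE FOR THE PRINTED REGIONS on the concrete carrier.
USED BY NAME, never restated: r14 g14 `B1Cor23RegularRegion.propagatorK_pairing_regular_region` (Cor. 2.3 at a regular `A`,
regions), r14 g14 `B1Ineq18RegularRegion.{gammaReg_pos, two_le_sitesPerDir}`, r14 g13 `B1Ineq233LowerRegularOnRegion.{ineq233_lower_
regularOn_region, ineq233_lower_printed_region}` ((2.33)ₗ, regularity on `Ω` only), r14 g9 `B1Prop23ZeroFieldRegion.{exists_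
indicatorLin, sep_sandwich, abs_mat_deltaKA_succ_le_at, hker_precOpA_of_deltaKA_at}`, `B1Ineq234ZeroFieldRegion.{ineq234_region,
ineq236_region, extL_restrict_eq}` (the Sect.-5 engine on supported configurations, general `A`), `B1Ineq234ZeroFieldRegionUniform.
{decay_transfer, profile_anti}` (scale transfer), `B1Cor23ZeroFieldRegion.siteInner_indicator_comm`, r14 g7 `B1Ineq234Concrete.
{mat_QGQ_eq, abs_mat_QGQ_le, pairing_block_of_sep, avgQkAdj_cb_eq_zero, profile, distC}`, typer `B1Eq230FluctCov.{mat, cb, deltaKA,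
precOpA, coeff221}`, `HiggsCondCov232.condCov232`, p15 `B2Eq328ConcretePieces.{pieceF, LSite}`, `B2Eq328DeltaK.extL`,
`B2Prop31ZeroFieldConcrete.mem_pieceF_iff`, `B2Eq337ScalarIntegration.Regions`, pv09/b04 `B4Sect5Torus.{cSt, dSt}`.

WHAT IS PRINTED (verbatim, [B1] p. 611 [PDF 9], OCR `p0009.txt` l. 8–11, 30–35): *"Proposition 2.2. If a configuration A is
regular in the same sense as in Proposition 2.1 then there exist constants δ₀ > 0 and c₀, depending on the same quantities as in
Proposition 2.1, such that |Δ^{(k)}(Ω, A; x, x′)| ≦ c₀exp(−δ₀|x − x′|), x, x′ ∈ Ω^{(k)}_1 (2.27)"*; *"Here we will assume that the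
set Λ is a union of big blocks of T^{(k)}_1. Proposition 2.3. If a configuration A is regular on Ω in the sense defined in
Proposition 2.1, then there exist positive constants δ₀, c₀, γ₀, γ₁ dependent on d and a, and independent of A, k, Ω and Λ, such
that"* [(2.33)] [(2.34): `|C^{(k)}_Λ(Ω, A; x, x′)| ≦ c₀exp(−δ₀|x − x′|)`] *"x, x′ ∈ Λ. (2.34)"*; p. 612: *"|δC^{(k)}_Λ(Ω, A; x, x′)| ≦
c₀exp(−δ₀(|x − x′| + dist(x, Λᶜ) + dist(x′, Λᶜ))), x, x′ ∈ Λ. (2.36)"*; p. 610 (2.23): *"|(∂^η_μA)(x)| ≦ c(e(L^kε))^{β−1}, x ∈ Ω"*.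

DICTIONARY.  As in `B1Prop23ZeroFieldRegion`: `Ω^{(k)} = Λ_k ↦ R.block j` (`k = j + 1`), `Ω = B^k(Λ_k) ↦ pieceF R j`,
`C^{(k)}_Λ(Ω, A) ↦ condCov232 C (pieceF R j) A m² a k Λ` (in `L^kε`-units, (2.30)/(2.32)), `aL^{−2}P(A) + Δ^{(k)}(Ω, A) ↦ precOpA`,
`|x − x′| ↦ Site.tdist`, `dist(x, Λᶜ) ↦ distC Λ`; «A regular on Ω» (2.23) ↦ `|A ⟨z + εe_ν, μ⟩ − A ⟨z, μ⟩| ≦ δ_A` for `z ∈ Ω` with the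
smallness thresholds of the two inputs (§5 packages them as `e² ≦ E₀`, `L^kδ_A ≦ c|e|` — (2.23) in lattice units with `β ≧ 0`).

WHAT THIS FILE PROVES (kernel-checked, zero `sorry`, theorems only; axioms standard).
* §1 the `Ω`-sandwich at a general `A`: `indicator_avgQkAdj_cb`, `mat_QGQ_sandwich_eq`, **`abs_mat_QGQ_region_le`** (`|(Q_k(A)GQ_k^*(A))
  (p,q)| ≤ c₀e^{δ₀}e^{−δ₀|x_p − x_q|}` on `Λ_k × Λ_k` from the pairing decay of `G` on `Ω`-supported sources).
* §2 **`ineq227_regular_region`** / **`ineq227_regular_region_uniform`** — PROPOSITION 2.2 (2.27) AT A REGULAR `A` FOR REGIONS: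
  `|Δ^{(k),L^kε}(Ω, A)(p, q)| ≤ (L^kε)^{−2}(a + a²(2/γ₀)e^{δ})e^{−δ|x_p − x_q|}` on `Λ_k × Λ_k`, `Ω = B^k(Λ_k)`, ANY `Λ_k ⊂ T^{(k)}`, every
  `1 ≤ k ≤ K`, `m² > 0`, every `A` regular on `Ω` with `d²·ε|e|·L^{2k}·δ_A ≤ 1/3`, `(4d + 4a)δ ≤ γ₀ = min{2, a(1 − L^{−2})/4}`.
* §3 **`hker_regular_region`** / **`hker_regular_region_uniform`** — (5.4) at a regular `A` on `Λ_k × Λ_k` for the printed regions,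
  constant `c_U·(L^kε)^{−2}`, `c_U = aL^{−2}e^{δ(L−1)} + a + a²(2/γ₀)e^{δ}`.
* §4 **`lower_supported_regular_region`** — r14 g13's (2.33)ₗ (regularity on `Ω` only) in the supported form the engine consumes.
* §5 **`ineq234_236_regular_region_of`** (the Sect.-5 engine + scale transfer from a supported lower bound `γ(L^kε)^{−2}` and a kernel
  bound `c_U(L^kε)^{−2}e^{−δ|·|}`: `|C^{(k)}_Λ(Ω,A)(p,q)| ≤ (L^kε)²c₁e^{−δ₁|x_p − x_q|}` and `|(C^{(k)}_Λ − C^{(k)})(Ω,A)(p,q)| ≤ (L^kε)²c₁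
  e^{−δ₁(|x_p − x_q| + dist(x_p,Λᶜ) + dist(x_q,Λᶜ))}`, `(c₁, δ₁) = (cSt, dSt)(N·K_d; γ, c_U, δ)`), and the PRINTED QUANTIFIER SHAPE
  **`prop23_regular_region`**: for `d`, `L > 1`, `a, m² > 0`, a regularity constant `c ≥ 0` and `N` there are `E₀, c₁, δ₁ > 0` such that
  for every charge with `e² ≤ E₀`, every torus of the model with these `d, L`, every region tower `R` (`K ≤ K_P`), every level
  `1 ≤ k = j + 1 < K_P` with `L^kε ≤ 1` and `Λ_k = R.block j` a union of blocks, EVERY `A` regular on `Ω = B^k(Λ_k)` with `L^kδ_A ≤ c|e|`,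
  every `Λ ⊂ Λ_k` and all `p, q` over `Λ`: (2.34) and (2.36) with constants `(L^kε)²c₁`, `δ₁` INDEPENDENT of `A, k, ε`, the volume,
  `Ω` and `Λ`.
HONEST SCOPE / DIVERGENCE.  (i) Constants explicit but crude; they depend on `(d, N, L, a, m², c)` — WEAKER than the printed *"dependent
on d and a"* (`m²` enters through r14 g13's `γ₀ = min{a(1 − L^{−2})/(8d + 2m² + 4), 1/16}`, `N` through the lattice-sum profile, `c`
through `E₀`); the factor `(L^kε)²` is the unit-lattice rescaling (2.31) of the covariance ((2.30) is in `L^kε`-units).  (ii) `Λ ⊂ Λ_k`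
arbitrary and `Λ_k` any union of blocks — the printed «big blocks» are not needed by the Sect.-5 route; `Ω = B^k(Λ_k)` exactly as
printed ((2.35): `Ω^{(k)} = Λ_k`); regularity of `A` asked on `Ω` only, as printed.  (iii) SMALL COUPLING: the two inputs need `δ_A`
small against `ε|e|L^{2k}` (Cor. 2.3) and against `e·L^k` ((2.33)ₗ); in the (2.23) currency `L^kδ_A ≤ c|e|` both follow from `e² ≤ E₀`
— this is the print's standing *"for e(L^kε) sufficiently small"* (Prop. 2.1), made explicit.  (iv) METHOD: Combes–Thomas for the
Cor.-2.3 input (r14 g14), not the print's random walk; (2.38) and the second–fourth pairings of (2.30) are not treated.  (v) Value =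
the `A ≠ 0`, printed-region case of Props. 2.2/2.3 now holds outright on the concrete carrier at small coupling; NOT summit progress.
-/

noncomputable section

open scoped BigOperators InnerProductSpace Matrix

namespace Literature.MathematicalPhysics.QuantumFieldTheory.Balaban1983to89.B1Prop23RegularRegion

open HiggsLattice HiggsAveraging HiggsCovariance HiggsCovariancePos B1Eq230FluctCov HiggsCondCov232
open HiggsFluctMeasure (coeff221)
open B4Sect5Torus (cSt dSt cSt_pos dSt_pos profile_nonneg)
open B2Eq337ScalarIntegration (Regions V)
open B2Eq328ConcretePieces (LSite pieceF)
open B2Eq328DeltaK (extL)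
open B2Prop31ZeroFieldConcrete (mem_pieceF_iff)
open B1Ineq233LowerZeroField (mesh_succ)
open B1Ineq234Concrete (profile profile_nonneg' nCol distC distC_nonneg mat_QGQ_eq abs_mat_QGQ_le pairing_block_of_sep
  avgQkAdj_cb_eq_zero)
open B1Ineq234ZeroFieldRegion (ineq234_region ineq236_region extL_restrict_eq)
open B1Ineq234ZeroFieldRegionUniform (decay_transfer profile_anti)
open B1Prop23ZeroFieldRegion (exists_indicatorLin sep_sandwich abs_mat_deltaKA_succ_le_at hker_precOpA_of_deltaKA_at)
open B1Cor23ZeroFieldRegion (siteInner_indicator_comm)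
open B1Cor23RegularRegion (propagatorK_pairing_regular_region)
open B1Ineq18RegularRegion (gammaReg_pos two_le_sitesPerDir)
open B1Ineq233LowerRegularOnRegion (ineq233_lower_regularOn_region ineq233_lower_printed_region)
open Matrix

variable {P : HiggsLattice.Params} {N : ℕ} {k : ℕ}

/-! ## §1 The `Ω`-sandwich `1_ΩG1_Ω` and the block-averaged kernel at a general `A` -/

section Sandwich

variable (Ω : Finset (HiggsLattice.Site P 0)) (C : ChargeData N) (A : HiggsLattice.VecField P 0)

/-- `1_Ω(Q_k^*(A)e_p) = Q_k^*(A)e_p` when the block `B^k(x_p)` lies in `Ω` (`Q_k^*(A)e_p` is supported in `B^k(x_p)`).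
[cite: Balaban1982Higgs1, (2.20) p.610] -/
theorem indicator_avgQkAdj_cb (Λk : Finset (HiggsLattice.Site P k)) (hΩ : ∀ x, blockIter k x ∈ Λk → x ∈ Ω)
    (p : HiggsLattice.Site P k × Ix N) (hp : p.1 ∈ Λk) :
    (fun x => if x ∈ Ω then avgQkAdj C A k (cb P N k p) x else 0) = avgQkAdj C A k (cb P N k p) := by
  funext x
  split_ifs with hx
  · rfl
  · have hne : blockIter k x ≠ p.1 := by
      intro h
      exact hx (hΩ x (h ▸ hp))
    exact (avgQkAdj_cb_eq_zero C A p hne).symm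

/-- **On `Λ_k × Λ_k` the block-averaged kernels of `G` and of `1_ΩG1_Ω` agree** at a general `A`: `(Q_k(A)GQ_k^*(A))(p, q) =
(Q_k(A)1_ΩG1_ΩQ_k^*(A))(p, q)` for `x_p, x_q ∈ Λ_k`, `B^k(Λ_k) ⊂ Ω`. [cite: Balaban1982Higgs1, (2.21) p.610] -/
theorem mat_QGQ_sandwich_eq (G : Module.End ℝ (ScalarField P 0 N)) (Pl : ScalarField P 0 N →ₗ[ℝ] ScalarField P 0 N)
    (hPl : ∀ f, Pl f = fun x => if x ∈ Ω then f x else 0) (Λk : Finset (HiggsLattice.Site P k))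
    (hΩ : ∀ x, blockIter k x ∈ Λk → x ∈ Ω) {p q : HiggsLattice.Site P k × Ix N} (hp : p.1 ∈ Λk) (hq : q.1 ∈ Λk) :
    mat (avgQkLin C A k ∘ₗ (Pl ∘ₗ G ∘ₗ Pl) ∘ₗ avgQkAdj C A k) p q = mat (avgQkLin C A k ∘ₗ G ∘ₗ avgQkAdj C A k) p q := by
  rw [mat_QGQ_eq, mat_QGQ_eq]
  congr 1
  rw [LinearMap.comp_apply, LinearMap.comp_apply, hPl (avgQkAdj C A k (cb P N k q)), indicator_avgQkAdj_cb Ω C A Λk hΩ q hq,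
    hPl, siteInner_indicator_comm, indicator_avgQkAdj_cb Ω C A Λk hΩ p hp]

/-- **`|(Q_k(A)GQ_k^*(A))(p, q)| ≤ c₀e^{δ₀}e^{−δ₀|x_p − x_q|}` ON `Λ_k × Λ_k` from the pairing decay of `G` on `Ω`-SUPPORTED SOURCES**
(`Ω = B^k(Λ_k)`, `k ≤ K`), general `A`: r14 g9's `sep_sandwich` + r14 g7's `pairing_block_of_sep`/`abs_mat_QGQ_le` for `1_ΩG1_Ω`,
then `mat_QGQ_sandwich_eq`. [cite: Balaban1983RegularityDecay, (5.4) p.593] -/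
theorem abs_mat_QGQ_region_le (hk : k ≤ P.K) (Λk : Finset (HiggsLattice.Site P k)) (hΩΛ : ∀ x, x ∈ Ω ↔ blockIter k x ∈ Λk)
    (G : Module.End ℝ (ScalarField P 0 N)) {c₀ δ₀ : ℝ} (hc : 0 ≤ c₀) (hδ : 0 ≤ δ₀)
    (hCT : ∀ (R : ℝ) (g g' : ScalarField P 0 N), (∀ x, x ∉ Ω → g' x = 0) →
      (∀ x x', g x ≠ 0 → g' x' ≠ 0 → R ≤ (HiggsLattice.Site.tdist x x' : ℝ)) →
        |siteInner g (G g')| ≤ c₀ * Real.exp (-(δ₀ * (R / (P.L : ℝ) ^ k))) *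
          Real.sqrt (siteInner g g) * Real.sqrt (siteInner g' g'))
    (p q : HiggsLattice.Site P k × Ix N) (hp : p.1 ∈ Λk) (hq : q.1 ∈ Λk) :
    |mat (avgQkLin C A k ∘ₗ G ∘ₗ avgQkAdj C A k) p q| ≤
      c₀ * Real.exp δ₀ * Real.exp (-(δ₀ * (HiggsLattice.Site.tdist p.1 q.1 : ℝ))) := by
  obtain ⟨Pl, hPl⟩ := exists_indicatorLin (P := P) (N := N) Ω
  have hS := sep_sandwich Ω G Pl hPl hc k hCT
  have hall := abs_mat_QGQ_le C A (Pl ∘ₗ G ∘ₗ Pl) hk (pairing_block_of_sep (Pl ∘ₗ G ∘ₗ Pl) hk hc hδ hS) p q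
  rwa [mat_QGQ_sandwich_eq Ω C A G Pl hPl Λk (fun x hx => (hΩΛ x).mpr hx) hp hq] at hall

end Sandwich

/-! ## §2 Proposition 2.2 (2.27) at a regular `A` for regions -/

section Prop22

variable (C : ChargeData N) {a msq : ℝ}

/-- **PROPOSITION 2.2 (2.27) AT A REGULAR `A` FOR REGIONS `Ω = B^k(Λ_k)`, `Λ_k ⊂ T^{(k)}` ANY SET OF BLOCK SITES, `1 ≤ k ≤ K`**
(`m² > 0`, `a > 0`, `L > 1`, `(4d + 4a)δ ≤ γ₀ = min{2, a(1 − L^{−2})/4}`, `A` regular on `Ω`: `|A ⟨z + εe_ν, μ⟩ − A ⟨z, μ⟩| ≤ δ_A`,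
`z ∈ Ω`, with `d²·ε|e|·L^{2k}·δ_A ≤ 1/3`): for `x_p, x_q ∈ Λ_k`,
`|Δ^{(k),L^kε}(Ω, A)(p, q)| ≤ (a_k(L^kε)^{−2} + (a_k(L^kε)^{−2})²(2/γ₀)(L^kε)²e^{δ})e^{−δ|x_p − x_q|}` — (2.21) `Δ^{(k)} = a_k −
a_k²Q_k(A)G^ε_k(Ω,A)Q_k^*(A)` fed with r14 g14's Cor. 2.3 for regions at a regular `A`. Print: *"|Δ^{(k)}(Ω, A; x, x′)| ≦
c₀exp(−δ₀|x − x′|), x, x′ ∈ Ω^{(k)}_1 (2.27)"*. [cite: Balaban1982Higgs1, Prop. 2.2 (2.27) p.611, (2.21) p.610] -/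
theorem ineq227_regular_region (ha : 0 < a) (hL : 1 < P.L) (hmsq : 0 < msq) (j : ℕ) (hk : j + 1 ≤ P.K)
    (Ω : Finset (HiggsLattice.Site P 0)) (Λk : Finset (HiggsLattice.Site P (j + 1)))
    (hΩΛ : ∀ x, x ∈ Ω ↔ blockIter (j + 1) x ∈ Λk) (A : HiggsLattice.VecField P 0) {δA : ℝ}
    (hreg : ∀ z ∈ Ω, ∀ μ ν : Fin P.d, |A ⟨z.shift ν, μ⟩ - A ⟨z, μ⟩| ≤ δA)
    (hsmall : (P.d : ℝ) ^ 2 * (P.mesh 0 * |C.e|) * ((P.L : ℝ) ^ (j + 1)) ^ 2 * δA ≤ 1 / 3)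
    {δ : ℝ} (hδ0 : 0 ≤ δ) (hδ : (4 * P.d + 4 * a) * δ ≤ min 2 (a * (1 - ((P.L : ℝ) ^ 2)⁻¹) / 4))
    (p q : HiggsLattice.Site P (j + 1) × Ix N) (hp : p.1 ∈ Λk) (hq : q.1 ∈ Λk) :
    |mat (deltaKA C Ω A msq a (j + 1)) p q| ≤
      (|coeff221 P a (j + 1)| + coeff221 P a (j + 1) ^ 2 *
          (2 / min 2 (a * (1 - ((P.L : ℝ) ^ 2)⁻¹) / 4) * P.mesh (j + 1) ^ 2 * Real.exp δ)) *
        Real.exp (-(δ * (HiggsLattice.Site.tdist p.1 q.1 : ℝ))) := by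
  have hγ := gammaReg_pos (P := P) ha hL
  have hc : 0 ≤ 2 / min 2 (a * (1 - ((P.L : ℝ) ^ 2)⁻¹) / 4) * P.mesh (j + 1) ^ 2 :=
    mul_nonneg (div_pos two_pos hγ).le (sq_nonneg _)
  have hΩ : ∀ x x' : HiggsLattice.Site P 0, blockIter (j + 1) x = blockIter (j + 1) x' → (x ∈ Ω ↔ x' ∈ Ω) := by
    intro x x' h
    rw [hΩΛ, hΩΛ, h]
  have hCT : ∀ (r : ℝ) (g g' : ScalarField P 0 N), (∀ x, x ∉ Ω → g' x = 0) →
      (∀ x x', g x ≠ 0 → g' x' ≠ 0 → r ≤ (HiggsLattice.Site.tdist x x' : ℝ)) →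
        |siteInner g (propagatorK C Ω A msq a (j + 1) g')| ≤
          2 / min 2 (a * (1 - ((P.L : ℝ) ^ 2)⁻¹) / 4) * P.mesh (j + 1) ^ 2 * Real.exp (-(δ * (r / (P.L : ℝ) ^ (j + 1)))) *
            Real.sqrt (siteInner g g) * Real.sqrt (siteInner g' g') :=
    fun r g g' hg' hsep => propagatorK_pairing_regular_region C ha hL hmsq (Nat.le_add_left 1 j) hk Ω hΩ A hreg hsmall hδ0
      hδ g g' hg' r hsep
  have hQGQ := abs_mat_QGQ_region_le Ω C A hk Λk hΩΛ (propagatorK C Ω A msq a (j + 1)) hc hδ0 hCT p q hp hq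
  have hΔ := abs_mat_deltaKA_succ_le_at C Ω A msq a j p q hQGQ
  calc _ ≤ _ := hΔ
    _ = _ := by ring

/-- **(2.27) at a regular `A` for regions with a constant UNIFORM IN THE LEVEL** (same data; `a_k ≤ a`, (2.16)):
`|Δ^{(k),L^kε}(Ω, A)(p, q)| ≤ (L^kε)^{−2}(a + a²(2/γ₀)e^{δ})e^{−δ|x_p − x_q|}` on `Λ_k × Λ_k` — for the operator rescaled to the unit
lattice ((2.22)) the constants `c₀ = a + a²(2/γ₀)e^{δ}`, `δ₀ = δ` depend on `d, L, a` only. [cite: Balaban1982Higgs1, Prop. 2.2 (2.27) p.611] -/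
theorem ineq227_regular_region_uniform (ha : 0 < a) (hL : 1 < P.L) (hmsq : 0 < msq) (j : ℕ) (hk : j + 1 ≤ P.K)
    (Ω : Finset (HiggsLattice.Site P 0)) (Λk : Finset (HiggsLattice.Site P (j + 1)))
    (hΩΛ : ∀ x, x ∈ Ω ↔ blockIter (j + 1) x ∈ Λk) (A : HiggsLattice.VecField P 0) {δA : ℝ}
    (hreg : ∀ z ∈ Ω, ∀ μ ν : Fin P.d, |A ⟨z.shift ν, μ⟩ - A ⟨z, μ⟩| ≤ δA)
    (hsmall : (P.d : ℝ) ^ 2 * (P.mesh 0 * |C.e|) * ((P.L : ℝ) ^ (j + 1)) ^ 2 * δA ≤ 1 / 3)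
    {δ : ℝ} (hδ0 : 0 ≤ δ) (hδ : (4 * P.d + 4 * a) * δ ≤ min 2 (a * (1 - ((P.L : ℝ) ^ 2)⁻¹) / 4))
    (p q : HiggsLattice.Site P (j + 1) × Ix N) (hp : p.1 ∈ Λk) (hq : q.1 ∈ Λk) :
    |mat (deltaKA C Ω A msq a (j + 1)) p q| ≤
      (P.mesh (j + 1))⁻¹ ^ 2 * (a + a ^ 2 * (2 / min 2 (a * (1 - ((P.L : ℝ) ^ 2)⁻¹) / 4) * Real.exp δ)) *
        Real.exp (-(δ * (HiggsLattice.Site.tdist p.1 q.1 : ℝ))) := by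
  have hL' : (1 : ℝ) < (P.L : ℝ) := by exact_mod_cast hL
  have hγ := gammaReg_pos (P := P) ha hL
  have hk1 : 1 ≤ j + 1 := Nat.le_add_left 1 j
  have hak0 : 0 < B1.aSeq a P.L (j + 1) := B1.aSeq_pos ha hL' hk1
  have hak : B1.aSeq a P.L (j + 1) ≤ a := B1.aSeq_le ha hL' (j + 1) hk1
  have hM : 0 < P.mesh (j + 1) := P.mesh_pos (j + 1)
  have hMi : 0 < (P.mesh (j + 1))⁻¹ ^ 2 := by positivity
  have h := ineq227_regular_region C ha hL hmsq j hk Ω Λk hΩΛ A hreg hsmall hδ0 hδ p q hp hq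
  refine h.trans (mul_le_mul_of_nonneg_right ?_ (Real.exp_pos _).le)
  rw [HiggsFluctMeasure.coeff221_eq, abs_of_pos (mul_pos hak0 hMi)]
  set g := 2 / min 2 (a * (1 - ((P.L : ℝ) ^ 2)⁻¹) / 4) with hg
  have hg0 : 0 ≤ g := (div_pos two_pos hγ).le
  have hE : 0 ≤ Real.exp δ := (Real.exp_pos δ).le
  have h1 : B1.aSeq a P.L (j + 1) * (P.mesh (j + 1))⁻¹ ^ 2 ≤ a * (P.mesh (j + 1))⁻¹ ^ 2 :=
    mul_le_mul_of_nonneg_right hak hMi.le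
  have h2 : (B1.aSeq a P.L (j + 1) * (P.mesh (j + 1))⁻¹ ^ 2) ^ 2 * (g * P.mesh (j + 1) ^ 2 * Real.exp δ)
      = B1.aSeq a P.L (j + 1) ^ 2 * (P.mesh (j + 1))⁻¹ ^ 2 * (g * Real.exp δ) := by
    field_simp
  have h3 : B1.aSeq a P.L (j + 1) ^ 2 ≤ a ^ 2 := pow_le_pow_left₀ hak0.le hak 2
  rw [h2]
  have h4 : B1.aSeq a P.L (j + 1) ^ 2 * (P.mesh (j + 1))⁻¹ ^ 2 * (g * Real.exp δ)
      ≤ a ^ 2 * (P.mesh (j + 1))⁻¹ ^ 2 * (g * Real.exp δ) :=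
    mul_le_mul_of_nonneg_right (mul_le_mul_of_nonneg_right h3 hMi.le) (mul_nonneg hg0 hE)
  calc B1.aSeq a P.L (j + 1) * (P.mesh (j + 1))⁻¹ ^ 2
        + B1.aSeq a P.L (j + 1) ^ 2 * (P.mesh (j + 1))⁻¹ ^ 2 * (g * Real.exp δ)
      ≤ a * (P.mesh (j + 1))⁻¹ ^ 2 + a ^ 2 * (P.mesh (j + 1))⁻¹ ^ 2 * (g * Real.exp δ) := add_le_add h1 h4
    _ = (P.mesh (j + 1))⁻¹ ^ 2 * (a + a ^ 2 * (g * Real.exp δ)) := by ring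

end Prop22

/-! ## §3 (5.4) at a regular `A` on `Λ_k × Λ_k` for the printed regions `Ω = B^k(Λ_k)` -/

section Kernel

variable {K : ℕ} (R : Regions P K) (C : ChargeData N) {a msq : ℝ}

/-- **(5.4) AT A REGULAR `A` FOR THE PRINTED REGIONS ON `Λ_k × Λ_k`** (`Λ_k = R.block j`, `Ω = B^k(Λ_k)`, `1 ≤ k = j + 1 < K`,
`m² > 0`, `a > 0`, `L > 1`, `(4d + 4a)δ ≤ γ₀ = min{2, a(1 − L^{−2})/4}`, `A` regular on `Ω` with `d²·ε|e|·L^{2k}·δ_A ≤ 1/3`):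
`|(a(L^{k+1}ε)^{−2}P(A) + Δ^{(k)}(Ω,A))(p, q)| ≤ c·e^{−δ|x_p − x_q|}` for `x_p, x_q ∈ Λ_k`,
`c = a(L^{k+1}ε)^{−2}e^{δ(L−1)} + (L^kε)^{−2}(a + a²(2/γ₀)e^{δ})`. [cite: Balaban1983RegularityDecay, (5.4) p.593] -/
theorem hker_regular_region (ha : 0 < a) (hL : 1 < P.L) (hmsq : 0 < msq) (j : Fin K) (hjK : j.val + 1 < P.K)
    (A : HiggsLattice.VecField P 0) {δA : ℝ}
    (hreg : ∀ z ∈ pieceF R j, ∀ μ ν : Fin P.d, |A ⟨z.shift ν, μ⟩ - A ⟨z, μ⟩| ≤ δA)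
    (hsmall : (P.d : ℝ) ^ 2 * (P.mesh 0 * |C.e|) * ((P.L : ℝ) ^ (j.val + 1)) ^ 2 * δA ≤ 1 / 3)
    {δ : ℝ} (hδ0 : 0 ≤ δ) (hδ : (4 * P.d + 4 * a) * δ ≤ min 2 (a * (1 - ((P.L : ℝ) ^ 2)⁻¹) / 4))
    (p q : HiggsLattice.Site P (j.val + 1) × Ix N) (hp : p.1 ∈ R.block j) (hq : q.1 ∈ R.block j) :
    |mat (precOpA C (pieceF R j) A msq a (j.val + 1)) p q| ≤
      (a * ((P.mesh (j.val + 1 + 1))⁻¹ ^ 2) * Real.exp (δ * ((P.L : ℝ) - 1)) +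
          (P.mesh (j.val + 1))⁻¹ ^ 2 * (a + a ^ 2 * (2 / min 2 (a * (1 - ((P.L : ℝ) ^ 2)⁻¹) / 4) * Real.exp δ))) *
        Real.exp (-(δ * (HiggsLattice.Site.tdist p.1 q.1 : ℝ))) := by
  have hΔ := ineq227_regular_region_uniform C ha hL hmsq j.val hjK.le (pieceF R j) (R.block j) (mem_pieceF_iff R j) A
    hreg hsmall hδ0 hδ p q hp hq
  exact hker_precOpA_of_deltaKA_at C (pieceF R j) A msq a hjK ha.le hδ0 p q hΔ

/-- **(5.4) at a regular `A` for the printed regions, constant `c_U·(L^kε)^{−2}` UNIFORM IN THE LEVEL**: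
`c_U = aL^{−2}e^{δ(L−1)} + a + a²(2/γ₀)e^{δ}` (`(L^{k+1}ε)^{−2} = L^{−2}(L^kε)^{−2}`). [cite: Balaban1983RegularityDecay, (5.4) p.593] -/
theorem hker_regular_region_uniform (ha : 0 < a) (hL : 1 < P.L) (hmsq : 0 < msq) (j : Fin K) (hjK : j.val + 1 < P.K)
    (A : HiggsLattice.VecField P 0) {δA : ℝ}
    (hreg : ∀ z ∈ pieceF R j, ∀ μ ν : Fin P.d, |A ⟨z.shift ν, μ⟩ - A ⟨z, μ⟩| ≤ δA)
    (hsmall : (P.d : ℝ) ^ 2 * (P.mesh 0 * |C.e|) * ((P.L : ℝ) ^ (j.val + 1)) ^ 2 * δA ≤ 1 / 3)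
    {δ : ℝ} (hδ0 : 0 ≤ δ) (hδ : (4 * P.d + 4 * a) * δ ≤ min 2 (a * (1 - ((P.L : ℝ) ^ 2)⁻¹) / 4))
    (p q : HiggsLattice.Site P (j.val + 1) × Ix N) (hp : p.1 ∈ R.block j) (hq : q.1 ∈ R.block j) :
    |mat (precOpA C (pieceF R j) A msq a (j.val + 1)) p q| ≤
      (a * ((P.L : ℝ) ^ 2)⁻¹ * Real.exp (δ * ((P.L : ℝ) - 1)) +
          (a + a ^ 2 * (2 / min 2 (a * (1 - ((P.L : ℝ) ^ 2)⁻¹) / 4) * Real.exp δ))) *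
        (P.mesh (j.val + 1))⁻¹ ^ 2 * Real.exp (-(δ * (HiggsLattice.Site.tdist p.1 q.1 : ℝ))) := by
  have h := hker_regular_region R C ha hL hmsq j hjK A hreg hsmall hδ0 hδ p q hp hq
  have hsucc : (P.mesh (j.val + 1 + 1))⁻¹ ^ 2 = ((P.L : ℝ) ^ 2)⁻¹ * (P.mesh (j.val + 1))⁻¹ ^ 2 := by
    rw [mesh_succ (j.val + 1), mul_inv, mul_pow, inv_pow]
  rw [hsucc] at h
  calc _ ≤ _ := h
    _ = _ := by ring

end Kernel

/-! ## §4 (2.33)ₗ at a background regular on `Ω`, in the supported form (r14 g13) -/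

section Lower

variable {K : ℕ} (R : Regions P K) (C : ChargeData N) {a msq : ℝ}

/-- **(2.33)ₗ AT A BACKGROUND REGULAR ON `Ω` ONLY, in the supported form the Sect.-5 engine consumes** (r14 g13's
`ineq233_lower_regularOn_region` + p15's `ψ̃ = f` for `f` vanishing off `Λ_k`): for `Λ_k = R.block j` a union of blocks,
`Ω = B^k(Λ_k)`, `1 ≤ k = j + 1 < K_P`, `L^kε ≤ 1`, r14 g13's smallness conditions, and EVERY field `f` on `T^{(k)}` vanishing off `Λ_k`:
`(min{a, 4γ₀}/(2L²))(L^kε)^{−2}‖f‖² ≤ ⟨f, (a(L^{k+1}ε)^{−2}P(A) + Δ^{(k),L^kε}(Ω, A))f⟩`.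
[cite: Balaban1982Higgs1, Prop. 2.3 (2.33) p.611, Prop. 2.1 (2.23) p.610] -/
theorem lower_supported_regular_region (ha : 0 < a) (hL : 1 < P.L) (hmsq : 0 < msq) (hK : K ≤ P.K) (j : Fin K)
    (hjK : j.val + 1 < P.K) (hs : P.mesh (j.val + 1) ≤ 1)
    (hU : ∀ y y' : HiggsLattice.Site P (j.val + 1),
      HiggsLattice.blockOf y = HiggsLattice.blockOf y' → (y ∈ R.block j ↔ y' ∈ R.block j))
    (A : HiggsLattice.VecField P 0) {δ : ℝ} (hδ : 0 ≤ δ)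
    (hreg : ∀ z ∈ pieceF R j, ∀ μ' ν : Fin P.d, |A ⟨z.shift ν, μ'⟩ - A ⟨z, μ'⟩| ≤ δ)
    (hsmall : 8 * (P.d : ℝ) ^ 4 * (P.L : ℝ) ^ P.d * C.e ^ 2 * P.mesh (j.val + 1) ^ 2 *
      ((P.L : ℝ) ^ (j.val + 1)) ^ 2 * δ ^ 2 ≤ 1 / 2)
    {γ₀ : ℝ} (hγ0 : 0 ≤ γ₀) (hγB : γ₀ * (8 * P.d + 2 * msq + 4) ≤ a * (1 - ((P.L : ℝ) ^ 2)⁻¹))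
    (hγ16 : γ₀ ≤ 1 / 16)
    (hE : 64 * γ₀ * (P.d : ℝ) ^ 3 * C.e ^ 2 * ((P.L : ℝ) ^ (j.val + 1)) ^ 2 * δ ^ 2 * P.mesh (j.val + 1) ^ 2
      ≤ min a (4 * γ₀) / (P.L : ℝ) ^ 2 / 4)
    (hθ : (P.L : ℝ) ^ 2 * P.d *
      (2 * P.d * P.L * ((P.L : ℝ) ^ (j.val + 1)) ^ 2 * (P.mesh 0 * |C.e|) * δ) ^ 2 ≤ 1)
    (f : ScalarField P (j.val + 1) N) (hf : ∀ y, y ∉ R.block j → f y = 0) :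
    min a (4 * γ₀) / (P.L : ℝ) ^ 2 / 2 * ((P.mesh (j.val + 1))⁻¹ ^ 2) * siteInner f f
      ≤ siteInner f (precOpA C (pieceF R j) A msq a (j.val + 1) f) := by
  have h := ineq233_lower_regularOn_region R C ha hL hmsq hK j hjK (fun μ => two_le_sitesPerDir _ μ) hs hU A hδ hreg
    hsmall hγ0 hγB hγ16 hE hθ (fun y : LSite R j => f y.val)
  rwa [extL_restrict_eq R j hf] at h

end Lower

/-! ## §5 Proposition 2.3 (2.34)/(2.36) at a regular `A` for the printed regions -/

section Prop23

variable {K : ℕ} (R : Regions P K) (C : ChargeData N) {a msq : ℝ}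

/-- **THE SECT.-5 ENGINE WITH SCALE TRANSFER, general `A`, printed regions** (`Λ_k = R.block j`, `Ω = B^k(Λ_k)`, `k = j + 1 ≤ K_P`,
`L^kε ≤ 1`, `m² > 0`, `a > 0`, `L > 1`): from a lower bound `γ(L^kε)^{−2}‖f‖² ≤ ⟨f, (a(L^{k+1}ε)^{−2}P(A) + Δ^{(k)}(Ω,A))f⟩` on the
fields vanishing off `Λ_k` (`γ > 0`) and a kernel bound `|(a(L^{k+1}ε)^{−2}P(A) + Δ^{(k)}(Ω,A))(p,q)| ≤ c_U(L^kε)^{−2}e^{−δ|x_p − x_q|}` on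
`Λ_k × Λ_k` (`c_U, δ > 0`): for every `Λ ⊂ Λ_k` and `x_p, x_q ∈ Λ`,
`|C^{(k)}_Λ(Ω,A)(p,q)| ≤ (L^kε)²c₁e^{−δ₁|x_p − x_q|}` and `|(C^{(k)}_Λ − C^{(k)})(Ω,A)(p,q)| ≤ (L^kε)²c₁e^{−δ₁(|x_p − x_q| + dist(x_p,Λᶜ) +
dist(x_q,Λᶜ))}`, `(c₁, δ₁) = (cSt, dSt)(N·K_d; γ, c_U, δ)` — r14 g9's `ineq234_region`/`ineq236_region` and `decay_transfer`.
[cite: Balaban1982Higgs1, Prop. 2.3 (2.34) p.611, (2.36) p.612] [cite: Balaban1983RegularityDecay, Sect. 5 (5.4)–(5.6) pp.593–594] -/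
theorem ineq234_236_regular_region_of (ha : 0 < a) (hL : 1 < P.L) (hmsq : 0 < msq) (j : Fin K) (hjK : j.val + 1 ≤ P.K)
    (hs : P.mesh (j.val + 1) ≤ 1) (A : HiggsLattice.VecField P 0) {γ : ℝ} (hγ : 0 < γ)
    (hlow : ∀ f : ScalarField P (j.val + 1) N, (∀ y, y ∉ R.block j → f y = 0) →
      γ * (P.mesh (j.val + 1))⁻¹ ^ 2 * siteInner f f ≤ siteInner f (precOpA C (pieceF R j) A msq a (j.val + 1) f))
    {cU δ : ℝ} (hcU : 0 < cU) (hδ : 0 < δ)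
    (hker : ∀ p q : HiggsLattice.Site P (j.val + 1) × Ix N, p.1 ∈ R.block j → q.1 ∈ R.block j →
      |mat (precOpA C (pieceF R j) A msq a (j.val + 1)) p q| ≤
        cU * (P.mesh (j.val + 1))⁻¹ ^ 2 * Real.exp (-(δ * (HiggsLattice.Site.tdist p.1 q.1 : ℝ))))
    {Λ : Finset (HiggsLattice.Site P (j.val + 1))} (hΛ : Λ ⊆ R.block j)
    {p q : HiggsLattice.Site P (j.val + 1) × Ix N} (hp : p.1 ∈ Λ) (hq : q.1 ∈ Λ) :
    |mat (condCov232 C (pieceF R j) A msq a (j.val + 1) Λ) p q| ≤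
        P.mesh (j.val + 1) ^ 2 * cSt (profile P N) γ cU δ *
          Real.exp (-(dSt (profile P N) γ cU δ * (HiggsLattice.Site.tdist p.1 q.1 : ℝ)))
      ∧ |mat (condCov232 C (pieceF R j) A msq a (j.val + 1) Λ) p q
            - mat (condCov232 C (pieceF R j) A msq a (j.val + 1) (R.block j)) p q| ≤
        P.mesh (j.val + 1) ^ 2 * cSt (profile P N) γ cU δ *
          Real.exp (-(dSt (profile P N) γ cU δ *
            ((HiggsLattice.Site.tdist p.1 q.1 : ℝ) + distC Λ p.1 + distC Λ q.1))) := by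
  have hm : 0 < P.mesh (j.val + 1) := P.mesh_pos _
  have hs0 : 0 < (P.mesh (j.val + 1))⁻¹ ^ 2 := by positivity
  have hs1 : 1 ≤ (P.mesh (j.val + 1))⁻¹ ^ 2 := by
    rw [inv_pow]
    exact one_le_inv_iff₀.mpr ⟨pow_pos hm 2, by nlinarith⟩
  have hsinv : ((P.mesh (j.val + 1))⁻¹ ^ 2)⁻¹ = P.mesh (j.val + 1) ^ 2 := by rw [inv_pow, inv_inv]
  have ht : 0 ≤ (HiggsLattice.Site.tdist p.1 q.1 : ℝ) := Nat.cast_nonneg _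
  have ht' : 0 ≤ (HiggsLattice.Site.tdist p.1 q.1 : ℝ) + distC Λ p.1 + distC Λ q.1 :=
    add_nonneg (add_nonneg ht (distC_nonneg Λ _)) (distC_nonneg Λ _)
  have hlow' : ∀ f : ScalarField P (j.val + 1) N, (∀ y, y ∉ R.block j → f y = 0) →
      γ * (P.mesh (j.val + 1))⁻¹ ^ 2 * siteInner f f ≤ siteInner f (precOpA C (pieceF R j) A msq a (j.val + 1) f) := hlow
  have hker' : ∀ p q : HiggsLattice.Site P (j.val + 1) × Ix N, p.1 ∈ R.block j → q.1 ∈ R.block j →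
      |mat (precOpA C (pieceF R j) A msq a (j.val + 1)) p q| ≤
        cU * (P.mesh (j.val + 1))⁻¹ ^ 2 * Real.exp (-(δ * (HiggsLattice.Site.tdist p.1 q.1 : ℝ))) := hker
  constructor
  · have main := ineq234_region C (pieceF R j) A msq a (mul_pos hγ hs0) (mul_pos hcU hs0) hδ hmsq ha hL hjK (R.block j)
      hlow' hker' hΛ hp hq
    have htr := decay_transfer (K := profile P N) profile_nonneg' profile_anti hγ hcU.le le_rfl hδ hs1 ht
    rw [hsinv] at htr
    exact main.trans (htr.trans_eq (by ring))
  · have main := ineq236_region C (pieceF R j) A msq a (mul_pos hγ hs0) (mul_pos hcU hs0) hδ hmsq ha hL hjK (R.block j)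
      hlow' hker' hΛ hp hq
    have htr := decay_transfer (K := profile P N) profile_nonneg' profile_anti hγ hcU.le le_rfl hδ hs1 ht'
    rw [hsinv] at htr
    exact main.trans (htr.trans_eq (by ring))

/-- **[B1] PROPOSITIONS 2.3 (2.34) AND (2.36) AT A REGULAR `A ≠ 0` FOR THE PRINTED REGIONS — THE PRINTED QUANTIFIER SHAPE** (p. 611
*"If a configuration A is regular on Ω in the sense defined in Proposition 2.1, then there exist positive constants δ₀, c₀, γ₀, γ₁
… independent of A, k, Ω and Λ, such that … x, x′ ∈ Λ. (2.34)"*, p. 612 (2.36)): for `d`, `L > 1`, `a, m² > 0`, a regularity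
constant `c ≥ 0` and `N` there are `E₀, c₁, δ₁ > 0` such that for every charge with `e² ≤ E₀`, every torus of the model with these
`d, L` (every volume, every `ε`), every region tower `R` (`K ≤ K_P`), every level `1 ≤ k = j + 1 < K_P` with `L^kε ≤ 1` and `Λ_k =
R.block j` a union of blocks, EVERY `A` regular on `Ω = B^k(Λ_k)` in the sense `|A ⟨z + εe_ν, μ⟩ − A ⟨z, μ⟩| ≤ δ_A` (`z ∈ Ω`) with
`L^kδ_A ≤ c|e|` — (2.23) `|(∂^ηA)(x)| ≦ ce(L^kε)^{β−1}`, `x ∈ Ω`, in lattice units, `β ≥ 0` — every `Λ ⊂ Λ_k` and all `p = (x, i)`,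
`q = (x′, i′)` with `x, x′ ∈ Λ`: `|C^{(k),L^kε}_Λ(Ω, A)(p, q)| ≤ (L^kε)²c₁e^{−δ₁|x − x′|}` and `|(C^{(k),L^kε}_Λ − C^{(k),L^kε})(Ω, A)(p, q)| ≤
(L^kε)²c₁e^{−δ₁(|x − x′| + dist(x,Λᶜ) + dist(x′,Λᶜ))}` — `(c₁, δ₁)` INDEPENDENT of `A`, `k`, `ε`, the volume, `Ω` and `Λ`.
[cite: Balaban1982Higgs1, Prop. 2.3 (2.34) p.611, (2.36) p.612, Prop. 2.1 (2.23) p.610] [cite: Balaban1983RegularityDecay, Sect. 5 p.594] -/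
theorem prop23_regular_region (d L : ℕ) (hL1 : 1 < L) {a msq : ℝ} (ha : 0 < a) (hmsq : 0 < msq) {c : ℝ} (hc : 0 ≤ c) (N : ℕ) :
    ∃ E₀ c₁ δ₁ : ℝ, 0 < E₀ ∧ 0 < c₁ ∧ 0 < δ₁ ∧
      ∀ (C : ChargeData N), C.e ^ 2 ≤ E₀ →
      ∀ (P : HiggsLattice.Params), P.d = d → P.L = L →
      ∀ {K : ℕ} (R : Regions P K), K ≤ P.K → ∀ (j : Fin K), j.val + 1 < P.K → P.mesh (j.val + 1) ≤ 1 →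
      (∀ y y' : HiggsLattice.Site P (j.val + 1),
        HiggsLattice.blockOf y = HiggsLattice.blockOf y' → (y ∈ R.block j ↔ y' ∈ R.block j)) →
      ∀ (A : HiggsLattice.VecField P 0) {δA : ℝ}, 0 ≤ δA →
        (∀ z ∈ pieceF R j, ∀ μ' ν : Fin P.d, |A ⟨z.shift ν, μ'⟩ - A ⟨z, μ'⟩| ≤ δA) →
        (P.L : ℝ) ^ (j.val + 1) * δA ≤ c * |C.e| →
        ∀ {Λ : Finset (HiggsLattice.Site P (j.val + 1))}, Λ ⊆ R.block j →
        ∀ {p q : HiggsLattice.Site P (j.val + 1) × Ix N}, p.1 ∈ Λ → q.1 ∈ Λ →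
          |mat (condCov232 C (pieceF R j) A msq a (j.val + 1) Λ) p q| ≤
              P.mesh (j.val + 1) ^ 2 * c₁ * Real.exp (-(δ₁ * (HiggsLattice.Site.tdist p.1 q.1 : ℝ)))
          ∧ |mat (condCov232 C (pieceF R j) A msq a (j.val + 1) Λ) p q
                - mat (condCov232 C (pieceF R j) A msq a (j.val + 1) (R.block j)) p q| ≤
              P.mesh (j.val + 1) ^ 2 * c₁ * Real.exp (-(δ₁ *
                ((HiggsLattice.Site.tdist p.1 q.1 : ℝ) + distC Λ p.1 + distC Λ q.1))) := by
  obtain ⟨E₀, hE₀, γ, hγ, hlowAll⟩ := ineq233_lower_printed_region d L hL1 ha hmsq c N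
  have hLr : (1 : ℝ) < (L : ℝ) := by exact_mod_cast hL1
  have hinv : ((L : ℝ) ^ 2)⁻¹ < 1 := inv_lt_one_of_one_lt₀ (by nlinarith)
  have hγr : 0 < min 2 (a * (1 - ((L : ℝ) ^ 2)⁻¹) / 4) :=
    lt_min (by norm_num) (by nlinarith [mul_pos ha (show (0:ℝ) < 1 - ((L : ℝ) ^ 2)⁻¹ by linarith)])
  have hden : (0 : ℝ) < 4 * d + 4 * a := by positivity
  -- the exponent `δ₀ = γ_r/(4d + 4a)` and the uniform kernel constant `c_U`
  obtain ⟨δ₀, hδ₀⟩ : ∃ δ₀ : ℝ, δ₀ = min 2 (a * (1 - ((L : ℝ) ^ 2)⁻¹) / 4) / (4 * d + 4 * a) := ⟨_, rfl⟩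
  have hδ₀pos : 0 < δ₀ := by rw [hδ₀]; exact div_pos hγr hden
  obtain ⟨cU, hcU⟩ : ∃ cU : ℝ, cU = a * ((L : ℝ) ^ 2)⁻¹ * Real.exp (δ₀ * ((L : ℝ) - 1)) +
      (a + a ^ 2 * (2 / min 2 (a * (1 - ((L : ℝ) ^ 2)⁻¹) / 4) * Real.exp δ₀)) := ⟨_, rfl⟩
  have hcUpos : 0 < cU := by rw [hcU]; positivity
  -- the coupling threshold: `e² ≤ E₀` (r14 g13) and `d²·c·e² ≤ 1/3` (r14 g14)
  obtain ⟨E₁, hE₁⟩ : ∃ E₁ : ℝ, E₁ = min E₀ (1 / (3 * ((d : ℝ) ^ 2 * c + 1))) := ⟨_, rfl⟩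
  have hE₁pos : 0 < E₁ := by rw [hE₁]; exact lt_min hE₀ (by positivity)
  refine ⟨E₁, cSt (fun t => (nCol N : ℝ) * B4Sect5Proof.latticeConst d t) γ cU δ₀,
    dSt (fun t => (nCol N : ℝ) * B4Sect5Proof.latticeConst d t) γ cU δ₀, hE₁pos, cSt_pos _ _ _ hγ,
    dSt_pos (profile_nonneg d (nCol N)) hγ hcUpos.le hδ₀pos, ?_⟩
  intro C heE P hPd hPL K R hK j hjK hs hU A δA hδA hreg hu Λ hΛ p q hp hq
  have heE₀ : C.e ^ 2 ≤ E₀ := heE.trans (by rw [hE₁]; exact min_le_left _ _)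
  have heE' : C.e ^ 2 ≤ 1 / (3 * ((d : ℝ) ^ 2 * c + 1)) := heE.trans (by rw [hE₁]; exact min_le_right _ _)
  have hlowψ := hlowAll C heE₀ P hPd hPL R hK j hjK (fun μ => two_le_sitesPerDir _ μ) hs hU A hδA hreg hu
  subst hPd hPL
  have hPL1 : 1 < P.L := hL1
  -- (2.33)ₗ in the supported form
  have hlow : ∀ f : ScalarField P (j.val + 1) N, (∀ y, y ∉ R.block j → f y = 0) →
      γ * (P.mesh (j.val + 1))⁻¹ ^ 2 * siteInner f f ≤ siteInner f (precOpA C (pieceF R j) A msq a (j.val + 1) f) := by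
    intro f hf
    have h := hlowψ (fun y : LSite R j => f y.val)
    rwa [extL_restrict_eq R j hf] at h
  -- the Cor.-2.3 smallness `d²·ε|e|·L^{2k}·δ_A ≤ 1/3` from `L^kδ_A ≤ c|e|`, `L^kε ≤ 1`, `d²ce² ≤ 1/3`
  have hm0 : 0 < P.mesh 0 := P.mesh_pos 0
  have hmesh : P.mesh (j.val + 1) = (P.L : ℝ) ^ (j.val + 1) * P.mesh 0 := by
    unfold HiggsLattice.Params.mesh; ring
  have hLk : (0 : ℝ) < (P.L : ℝ) ^ (j.val + 1) := pow_pos (by exact_mod_cast P.hL) _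
  have hsmall : (P.d : ℝ) ^ 2 * (P.mesh 0 * |C.e|) * ((P.L : ℝ) ^ (j.val + 1)) ^ 2 * δA ≤ 1 / 3 := by
    have he0 : 0 ≤ |C.e| := abs_nonneg _
    have h1 : (P.d : ℝ) ^ 2 * (P.mesh 0 * |C.e|) * ((P.L : ℝ) ^ (j.val + 1)) ^ 2 * δA
        = (P.d : ℝ) ^ 2 * P.mesh (j.val + 1) * (|C.e| * ((P.L : ℝ) ^ (j.val + 1) * δA)) := by
      rw [hmesh]; ring
    rw [h1]
    have h2 : |C.e| * ((P.L : ℝ) ^ (j.val + 1) * δA) ≤ |C.e| * (c * |C.e|) := mul_le_mul_of_nonneg_left hu he0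
    have h3 : |C.e| * (c * |C.e|) = c * C.e ^ 2 := by rw [← sq_abs]; ring
    have h4 : (P.d : ℝ) ^ 2 * P.mesh (j.val + 1) ≤ (P.d : ℝ) ^ 2 * 1 := mul_le_mul_of_nonneg_left hs (sq_nonneg _)
    have h5 : 0 ≤ |C.e| * ((P.L : ℝ) ^ (j.val + 1) * δA) := mul_nonneg he0 (mul_nonneg hLk.le hδA)
    have h6 : (P.d : ℝ) ^ 2 * c * C.e ^ 2 ≤ 1 / 3 := by
      have h7 : (P.d : ℝ) ^ 2 * c * C.e ^ 2 ≤ ((P.d : ℝ) ^ 2 * c) * (1 / (3 * ((P.d : ℝ) ^ 2 * c + 1))) :=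
        mul_le_mul_of_nonneg_left heE' (by positivity)
      have h8 : ((P.d : ℝ) ^ 2 * c) * (1 / (3 * ((P.d : ℝ) ^ 2 * c + 1))) ≤ 1 / 3 := by
        rw [mul_one_div, div_le_div_iff₀ (by positivity) (by norm_num)]
        nlinarith [mul_nonneg (sq_nonneg (P.d : ℝ)) hc]
      linarith
    calc (P.d : ℝ) ^ 2 * P.mesh (j.val + 1) * (|C.e| * ((P.L : ℝ) ^ (j.val + 1) * δA))
        ≤ (P.d : ℝ) ^ 2 * 1 * (|C.e| * (c * |C.e|)) :=
          mul_le_mul h4 h2 h5 (by positivity)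
      _ = (P.d : ℝ) ^ 2 * c * C.e ^ 2 := by rw [h3]; ring
      _ ≤ 1 / 3 := h6
  -- (5.4) with the uniform constant
  have hδ₀adm : (4 * (P.d : ℝ) + 4 * a) * δ₀ ≤ min 2 (a * (1 - ((P.L : ℝ) ^ 2)⁻¹) / 4) := by
    rw [hδ₀]; exact le_of_eq (mul_div_cancel₀ _ hden.ne')
  have hker : ∀ p q : HiggsLattice.Site P (j.val + 1) × Ix N, p.1 ∈ R.block j → q.1 ∈ R.block j →
      |mat (precOpA C (pieceF R j) A msq a (j.val + 1)) p q| ≤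
        cU * (P.mesh (j.val + 1))⁻¹ ^ 2 * Real.exp (-(δ₀ * (HiggsLattice.Site.tdist p.1 q.1 : ℝ))) := by
    intro p q hp hq
    rw [hcU]
    exact hker_regular_region_uniform R C ha hPL1 hmsq j hjK A hreg hsmall hδ₀pos.le hδ₀adm p q hp hq
  exact ineq234_236_regular_region_of R C ha hPL1 hmsq j hjK.le hs A hγ hlow hcUpos hδ₀pos hker hΛ hp hq

end Prop23

end Literature.MathematicalPhysics.QuantumFieldTheory.Balaban1983to89.B1Prop23RegularRegion

end
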